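import Mathlib
import Literature.NumberTheory.LFunctions.RiemannXi
import Literature.NumberTheory.LFunctions.DobnerNewman
import Literature.NumberTheory.LFunctions.LagariasXiShiftHermiteBiehlerProofs
import Literature.NumberTheory.LFunctions.RiemannXiLogDeriv
import Literature.NumberTheory.LFunctions.GeneralizedRH
import HarnessLib

/-!
# Suzuki's arithmetic canonical systems for `ζ`: the structure functions `E^{ω,ν}`, the kernel
# `K^{ω,ν}`, the operators `𝖪[t]`, the Hamiltonians `H^{ω,ν}`, and the printed theorems about them

Topic `Literature/NumberTheory/LFunctions`, next to `ZetaScrew.lean` (Suzuki 2023, the screw function)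
and `LagariasXiShiftHermiteBiehler{,Proofs}.lean` (Lagarias 2005, Lemma 2.1, PROVED). Requested by the
RH criterion column DBR (cell `run/shared/lean/pub/rh-dbr`, door "E-CS", WANTED W2): the objects and
printed theorems of

> M. Suzuki, *Hamiltonians arising from L-functions in the Selberg class*, J. Funct. Anal. **281**
> (2021) 109116 = arXiv:1606.05726 [Suzuki2021Hamiltonians], specialised to `L = ζ`
> (`d_ζ = 1`, `ε_ζ = 1`, `r = 1`, `λ₁ = 1/2`, `μ₁ = 0`, `m_ζ = 1`),

AS PRINTED (arXiv text pages): the structure function `E^{ω,ν}(z) = ξ(½+ω−iz)^ν` (2.4); the symbol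
`Θ^{ω,ν} = E♯/E = (ξ(½−ω−iz)/ξ(½+ω−iz))^ν` (2.5); the kernel
`K^{ω,ν}(x) = (1/2π)∫ Θ(u+iv) e^{−ix(u+iv)} du` (2.6), here on the line `v = 1 + ω`, where for
`νω > 1` (condition (2.8) for `d_ζ = 1`) the integral converges absolutely (`|Θ(u+iv)| ≍ |u|^{−νω}`,
Stirling) and is independent of `v > ½ + ω` (Prop. 4.1 (3)); the arithmetic coefficients
`q^{ω,ν}(n) = n^ω Σ_{d|n} d_ν(n/d) μ_ν(d) d^{−2ω}` (4.7) (`a_ζ = 1`, `a_ζ^ν = d_ν`, `a_ζ^{−ν} = μ^{∗ν}`);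
the operator `𝖪[t] f(x) = 1_{(−∞,t]}(x) ∫_{−∞}^t K(x+y) f(y) dy` on `L²(−∞,t)` (2.9), which — `K`
vanishing on `(−∞,0)`, Prop. 4.1 (1) — lives on `L²(−t,t)`; Fredholm's determinant (§3.2) by
Fredholm's series; `γ(t) = (det(1+𝖪[t])/det(1−𝖪[t]))²` and `H(t) = diag(1/γ(t), γ(t))` (2.10).

## Printed theorems vendored here (for `L = ζ`)

* `Suzuki2021_prop22` — **Prop. 2.2** («`E_L^{ω,ν}` belongs to HB for every `ω > ½` unconditionally
  and for every `0 < ω ≤ ½` under GRH(L)»), unconditional half, with Suzuki's definition of the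
  class (§1, (1.3)): `HB̄` = {`|E♯(z)| < |E(z)|` for all `z ∈ ℂ₊`} and `HB = HB̄ ∩ {no real zeros}`
  (`E♯(z) = conj(E(z̄))`; for our `E`, `|E♯(z)| = |E(z̄)|`); **PROVED** here (`Suzuki2021_prop22_holds`)
  for all `ω ≥ ½` from the tree's `lagarias2005_lemma_2_1_holds` (Lagarias 2005, Lemma 2.1:
  `|ξ(h+s)| > |ξ(h+1−s̄)|`, `h ≥ ½`, `Re s > ½`) and `riemannXi_ne_zero_of_one_le_re` (`ξ ≠ 0` on
  `Re s ≥ 1`) — so the fact carries no debt and even includes the boundary `ω = ½`.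
* `Suzuki2021_thm21` — **Thm. 2.1 / Prop. 4.2** (existence of `τ = τ(ζ;ω,ν) > 0` with `±1` not
  eigenvalues of `𝖪[t]`, `0 ≤ t < τ`, under (2.8)). Named fact.
* `Suzuki2021_prop41` — **Prop. 4.1 (1), (3)** for `νω > 1`: `K` vanishes on `(−∞,0)` and is the
  finite arithmetic sum `K(x) = Σ_{1 ≤ n ≤ e^x} q(n) n^{−1/2} G(x − log n)` for `x > 0`, with
  `G = G_ζ^{ω,ν}` the archimedean constituent (defined here SPECTRALLY from the `ξ_∞`-ratio; equal
  to Suzuki's `r ∗ g̃` by (4.10)–(4.12)). Named fact (the printed proof: Mellin–Barnes / Beta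
  integral (4.10), Dirichlet expansion, Fubini).
* `Suzuki2021_prop44` — **Prop. 4.4** (§4.4 «Non-vanishing of Fredholm determinants: conditional
  cases»: if `E^{ω,ν} ∈ HB` then `1 ± 𝖪[t]` are invertible for every `t ≥ 0`), stated with the HB
  hypothesis (BOTH clauses: the strict inequality on `ℂ₊` and no real zeros) explicit. Named fact (printed proof: `‖𝖪[t]‖ ≤ 1` from `Θ` inner, Lemma 3.2, and the
  compact-support contradiction Lemma 4.4).
* PROVED consequence: `suzuki2021_windows_of_half_le` — for `ω ≥ ½`, `νω > 1`, every window holds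
  (`Prop. 2.2 + Prop. 4.4`; conditional only on `Suzuki2021_prop44`).
* `Suzuki2021_prop43` — **Prop. 4.3 (1) ⇔ (2)** («`L(s) ≠ 0` for `Re s > ½ + ω₀`» ⇔ «`E_L^{ω,ν} ∈ HB`
  for every `ω > ω₀`»), **PROVED** for `L = ζ` by Lagarias' Hadamard-product comparison under the
  zero-free hypothesis (`norm_riemannXi_shift_reflect_lt_of_zeroFree`), with the RH-EQUIVALENT corollary
  `riemannHypothesis_iff_forall_isSuzukiHB` (ω₀ = 0).

## Deliberately NOT here (round 2 of the DBR column's W2)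

Thm. 2.2 (the solutions `(A(t,z), B(t,z))` (2.12)), Thm. 2.3 and **Thm. 2.4** (the GRH-EQUIVALENCE via
`det(1 ± 𝖪[t]) ≠ 0 ∀t` along `ω_n ↓ 0` AND `lim_{t→∞} J(t;z,z) = 0`) — they need the reproducing kernel
`J(t;z,w)` of the solution family, not typed yet; Prop. 4.3 (3) («meromorphic inner»; (1) ⇔ (2) IS here,
PROVED: `Suzuki2021_prop43`, with the corollary `riemannHypothesis_iff_forall_isSuzukiHB`);
Suzuki, ASPM 84 (2020) = arXiv:1907.07302, Thm. 1.1 (`m(t) = 1/Φ(t,t) = Ψ(t,t)` from ONE integral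
equation) and Thm. 1.2 (the single-operator kernel `K_θ`, `θ > 1`, (K-ii)–(K-v)); Bornemann, Math.
Comp. 79 (2010), Thms. 6.1–6.2 (Nyström/quadrature error for Fredholm determinants). Printed OPEN
QUESTIONS (not facts): §2.5 «the result [Su12] suggests that the genuine interval in Inv(E_L^{ω,ν}) is
the half-line [0,∞)»; ASPM 2020 p. 2 «It is expected that we can take τ₁ > 0 arbitrary small, but it
is not yet proved rigorously» and «it would be better … an equivalent condition using only one single
operator avoiding parameters ω and ν».

## References

* [Suzuki2021Hamiltonians] M. Suzuki, J. Funct. Anal. 281 (2021) 109116, arXiv:1606.05726: (2.4)–(2.10),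
  Prop. 2.2, Thm. 2.1, Prop. 4.1, Prop. 4.2, Prop. 4.4.
* [Lagarias2005] J. C. Lagarias, Acta Arith. 120 (2005) 159–184, Lemma 2.1 (tree, proved).
* [Suzuki2020IntegralOperators] M. Suzuki, Adv. Stud. Pure Math. 84 (2020) 399–411, arXiv:1907.07302.
* [Bornemann2010FredholmDeterminants] F. Bornemann, Math. Comp. 79 (2010) 871–915.
-/

noncomputable section

open MeasureTheory Complex
open scoped ComplexConjugate

namespace Literature.NumberTheory.LFunctions

/-! ## The objects (all RH-free: line integrals in the half-plane of absolute convergence, Dirichlet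
coefficients, Fredholm's series) -/

/-- Suzuki's structure function `E_ζ^{ω,ν}(z) = ξ(½ + ω − iz)^ν` (`ω > 0`, `ν ≥ 1`).
[cite: Suzuki2021Hamiltonians, eq. (2.4)] -/
def suzukiE (ω : ℝ) (ν : ℕ) (z : ℂ) : ℂ :=
  riemannXi (1 / 2 + ω - I * z) ^ ν

/-- `Θ_ζ^{ω,ν}(z) = E♯(z)/E(z) = E(−z)/E(z) = (ξ(½ − ω − iz)/ξ(½ + ω − iz))^ν` (`ε_ζ = 1`, using
`ξ(s) = ξ(1 − s)`). [cite: Suzuki2021Hamiltonians, eq. (2.5)] -/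
def suzukiTheta (ω : ℝ) (ν : ℕ) (z : ℂ) : ℂ :=
  (riemannXi (1 / 2 - ω - I * z) / riemannXi (1 / 2 + ω - I * z)) ^ ν

/-- The archimedean part of `Θ`: `(ξ_∞(½ − ω − iz)/ξ_∞(½ + ω − iz))^ν` with
`ξ_∞(s) = ½ s(s−1) Γ_ℝ(s)` (the tree's `xiGammaFactor`; `ξ = ξ_∞ · ζ`). Its inverse Fourier transform is
Suzuki's `G_ζ^{ω,ν}` ((4.10)–(4.12): `g = r ∗ g̃`). [cite: Suzuki2021Hamiltonians, §4.1, eqs. (4.10)–(4.12)] -/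
def suzukiThetaArch (ω : ℝ) (ν : ℕ) (z : ℂ) : ℂ :=
  (xiGammaFactor (1 / 2 - ω - I * z) / xiGammaFactor (1 / 2 + ω - I * z)) ^ ν

/-- Inverse Fourier transform along the horizontal line `Im z = c`:
`(1/2π) ∫_{Im z = c} Φ(z) e^{−izx} dz = (1/2π) ∫_ℝ Φ(u + ic) e^{−i(u+ic)x} du` (Bochner integral; `0`
if not integrable). [cite: Suzuki2021Hamiltonians, eq. (2.6)] -/
def invFourierLine (Φ : ℂ → ℂ) (c : ℝ) (x : ℝ) : ℂ :=
  (1 : ℂ) / (2 * (Real.pi : ℂ)) * ∫ u : ℝ, Φ (u + c * I) * Complex.exp (-I * (u + c * I) * x)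

/-- Suzuki's kernel `K_ζ^{ω,ν}(x) = (1/2π) ∫ Θ(u+iv) e^{−ix(u+iv)} du`, taken on the line `v = 1 + ω`
(inside `Im z > ½ + ω`, where `Θ` is a `Γ`-ratio times an absolutely convergent Dirichlet series —
no zero of `ζ` enters); for `νω > 1` the integral converges absolutely and does not depend on the
line (Prop. 4.1 (3)); real-valued (we take the real part; junk outside `νω > 1`).
[cite: Suzuki2021Hamiltonians, eq. (2.6)] -/
def suzukiKernel (ω : ℝ) (ν : ℕ) (x : ℝ) : ℝ :=
  (invFourierLine (suzukiTheta ω ν) (1 + ω) x).re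

/-- The archimedean constituent `G_ζ^{ω,ν}(x) = g_ζ^{ω,ν}(eˣ)` of the kernel, defined spectrally as the
inverse Fourier transform of the `ξ_∞`-ratio on `Im z = 1 + ω` (support in `[0,∞)`).
[cite: Suzuki2021Hamiltonians, eq. (4.8)] -/
def suzukiArchKernel (ω : ℝ) (ν : ℕ) (x : ℝ) : ℝ :=
  (invFourierLine (suzukiThetaArch ω ν) (1 + ω) x).re

/-- The arithmetic function `n ↦ n^a` (`a` real; value `0` at `0`). [folklore] -/
def rpowArith (a : ℝ) : ArithmeticFunction ℝ :=
  ⟨fun n => if n = 0 then 0 else (n : ℝ) ^ a, by simp⟩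

/-- Suzuki's Dirichlet coefficients for `ζ`: `q_ζ^{ω,ν}(n) = n^ω Σ_{d|n} d_ν(n/d) μ^{∗ν}(d) d^{−2ω}`, i.e.
`q = N^ω ⊙ (𝟙^{∗ν} ∗ (μ ⊙ N^{−2ω})^{∗ν})` (`∗` Dirichlet convolution, `⊙` pointwise product), so that
formally `Σ q(n) n^{−s} = (ζ(s−ω)/ζ(s+ω))^ν`. [cite: Suzuki2021Hamiltonians, eq. (4.7)] -/
def suzukiCoeff (ω : ℝ) (ν : ℕ) : ArithmeticFunction ℝ :=
  (rpowArith ω).pmul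
    (((ArithmeticFunction.zeta : ArithmeticFunction ℝ) ^ ν) *
      (((ArithmeticFunction.moebius : ArithmeticFunction ℝ).pmul (rpowArith (-2 * ω))) ^ ν))

/-- Fredholm's determinant `det(1 − μ 𝖪[t])` of the integral operator with kernel `K(x+y)` on
`L²(−t,t)`, by Fredholm's series `Σ_n (−μ)ⁿ/n! ∫_{(−t,t)ⁿ} det[K(x_i + x_j)]_{i,j≤n} dx` (absolutely
convergent for bounded measurable `K` on bounded intervals, Hadamard's inequality).
[cite: Suzuki2021Hamiltonians, §3.2] -/
def fredholmDet (K : ℝ → ℝ) (μ t : ℝ) : ℝ :=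
  ∑' n : ℕ, (-μ) ^ n / (n.factorial : ℝ) *
    ∫ x in Set.pi Set.univ (fun _ : Fin n => Set.Ioo (-t) t),
      (Matrix.of fun i j : Fin n => K (x i + x j)).det

/-- `γ_ζ^{ω,ν}(t) = (det(1 + 𝖪[t]) / det(1 − 𝖪[t]))²`. [cite: Suzuki2021Hamiltonians, eq. (2.10)] -/
def suzukiGamma (ω : ℝ) (ν : ℕ) (t : ℝ) : ℝ :=
  (fredholmDet (suzukiKernel ω ν) (-1) t / fredholmDet (suzukiKernel ω ν) 1 t) ^ 2

/-- Suzuki's Hamiltonian `H_ζ^{ω,ν}(t) = diag(1/γ(t), γ(t))` of the canonical system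
`−d/dt (A,B)ᵀ = z [[0,−1],[1,0]] H(t) (A,B)ᵀ` (2.11); positive definite and of determinant one by
construction wherever both Fredholm determinants are non-zero. [cite: Suzuki2021Hamiltonians, eq. (2.10)] -/
def suzukiHamiltonian (ω : ℝ) (ν : ℕ) (t : ℝ) : Matrix (Fin 2) (Fin 2) ℝ :=
  !![1 / suzukiGamma ω ν t, 0; 0, suzukiGamma ω ν t]

/-- "`±1` is not an eigenvalue of the operator `f ↦ ∫_{−t}^{t} K(·+y) f(y) dy` on `L²(−t,t)`" — Suzuki's
condition (K5) at time `t` for `𝖪[t]` on `L²(−∞,t)` (2.9) (equivalent for kernels vanishing on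
`(−∞,0)`, since then an eigenfunction in `L²(−∞,t)` vanishes below `−t`); by Fredholm theory it is
`det(1 ∓ 𝖪[t]) ≠ 0`. [cite: Suzuki2021Hamiltonians, eq. (2.9) and Thm. 2.1] -/
def NoUnitEigenvalue (K : ℝ → ℝ) (t : ℝ) : Prop :=
  ∀ ε : ℝ, (ε = 1 ∨ ε = -1) →
    ∀ f : ℝ → ℝ, MemLp f 2 (volume.restrict (Set.Ioo (-t) t)) →
      (∀ᵐ x ∂(volume.restrict (Set.Ioo (-t) t)),
          ∫ y in Set.Ioo (-t) t, K (x + y) * f y = ε * f x) →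
      f =ᵐ[volume.restrict (Set.Ioo (-t) t)] 0

/-! ## Unfolding lemmas -/

/-- `E^{ω,1} = ξ(½ + ω − iz)`. [cite: Suzuki2021Hamiltonians, eq. (2.4)] -/
theorem suzukiE_one (ω : ℝ) (z : ℂ) : suzukiE ω 1 z = riemannXi (1 / 2 + ω - I * z) := by
  simp [suzukiE]

/-- `E^{ω,0} ≡ 1` (degenerate; the printed range is `ν ≥ 1`). [cite: Suzuki2021Hamiltonians, eq. (2.4)] -/
theorem suzukiE_zero (ω : ℝ) (z : ℂ) : suzukiE ω 0 z = 1 := by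
  simp [suzukiE]

/-- `γ(t) ≥ 0` (a square). [cite: Suzuki2021Hamiltonians, eq. (2.10)] -/
theorem suzukiGamma_nonneg (ω : ℝ) (ν : ℕ) (t : ℝ) : 0 ≤ suzukiGamma ω ν t := by
  unfold suzukiGamma
  positivity

/-- `det H(t) = 1` whenever `γ(t) ≠ 0` ("Hamiltonians of determinant one").
[cite: Suzuki2021Hamiltonians, eq. (2.10)] -/
theorem suzukiHamiltonian_det {ω : ℝ} {ν : ℕ} {t : ℝ} (h : suzukiGamma ω ν t ≠ 0) :
    (suzukiHamiltonian ω ν t).det = 1 := by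
  rw [suzukiHamiltonian, Matrix.det_fin_two_of, mul_zero, sub_zero, one_div, inv_mul_cancel₀ h]

/-- `H(t)` is positive definite whenever `γ(t) ≠ 0` (hence `γ(t) > 0`): «positive definite by
construction». [cite: Suzuki2021Hamiltonians, eq. (2.10)] -/
theorem suzukiHamiltonian_posDef {ω : ℝ} {ν : ℕ} {t : ℝ} (h : suzukiGamma ω ν t ≠ 0) :
    (suzukiHamiltonian ω ν t).PosDef := by
  have hpos : 0 < suzukiGamma ω ν t := lt_of_le_of_ne (suzukiGamma_nonneg ω ν t) (Ne.symm h)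
  have hdiag : suzukiHamiltonian ω ν t = Matrix.diagonal ![1 / suzukiGamma ω ν t, suzukiGamma ω ν t] := by
    ext i j
    fin_cases i <;> fin_cases j <;> simp [suzukiHamiltonian, Matrix.diagonal]
  rw [hdiag, Matrix.posDef_diagonal_iff]
  intro i
  fin_cases i
  · simpa using one_div_pos.mpr hpos
  · simpa using hpos

/-! ## The printed theorems (for `L = ζ`) -/

/-- Suzuki's Hermite–Biehler class `HB` (§1, (1.3) and footnote): `E ∈ HB̄` iff `|E♯(z)| < |E(z)|` for
all `z ∈ ℂ₊`, and `HB = HB̄ ∩ {no real zeros}`, where `E♯(z) = conj (E (conj z))`, so that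
`|E♯(z)| = |E(z̄)|` — we state the inequality with `E(z̄)`, as Lagarias 2005 Lemma 6.1 and the tree do
(for `E = suzukiE ω ν` one has moreover `E♯(z) = E(−z)` since `ξ(s̄) = conj ξ(s)`, cf. (2.5)).
[cite: Suzuki2021Hamiltonians, §1 eq. (1.3)] -/
def IsSuzukiHB (E : ℂ → ℂ) : Prop :=
  (∀ z : ℂ, 0 < z.im → ‖E (conj z)‖ < ‖E z‖) ∧ ∀ x : ℝ, E x ≠ 0

/-- **Suzuki 2021, Prop. 2.2 (unconditional half), for `L = ζ`** — RH-FREE KNOWN THEOREM: for every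
`ω ≥ ½` and `ν ≥ 1`, `E_ζ^{ω,ν}` is in Suzuki's Hermite–Biehler class `HB`:
`|E(z̄)| < |E(z)|` for `Im z > 0` AND no real zeros (`IsSuzukiHB`) (printed: «`E_L^{ω,ν}` belongs to HB for every `ω > 1/2`
unconditionally and for every `0 < ω ≤ 1/2` under GRH(L)»; HB = no real zeros and `|E♯| < |E|` on
`ℂ₊`, `E♯(z) = \overline{E(z̄)}`; the boundary case `ω = ½` is included here because Lagarias 2005,
Lemma 2.1 covers `h ≥ ½` — it rests on `ζ ≠ 0` on `Re s = 1`). PROVED below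
(`Suzuki2021_prop22_holds`). [cite: Suzuki2021Hamiltonians, Prop. 2.2] -/
def Suzuki2021_prop22 : Prop :=
  ∀ ω : ℝ, 1 / 2 ≤ ω → ∀ ν : ℕ, 1 ≤ ν → IsSuzukiHB (suzukiE ω ν)

/-- Discharge of `Suzuki2021_prop22` from Lagarias 2005, Lemma 2.1 (tree:
`lagarias2005_lemma_2_1_holds`, via `.structureFunction`: `|ξ(½+h−i z̄)| < |ξ(½+h−iz)|`, `h ≥ ½`,
`Im z > 0`), monotonicity of `x ↦ x^ν` on `[0,∞)`, and `ξ ≠ 0` on `Re s ≥ 1`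
(`riemannXi_ne_zero_of_one_le_re`) for the real zeros. [cite: Suzuki2021Hamiltonians, Prop. 2.2] -/
theorem Suzuki2021_prop22_holds : Suzuki2021_prop22 := by
  intro ω hω ν hν
  refine ⟨fun z hz => ?_, fun x => ?_⟩
  · have key := lagarias2005_lemma_2_1_holds.structureFunction hω hz
    simp only [suzukiE, norm_pow]
    exact pow_lt_pow_left₀ key (norm_nonneg _) (by omega)
  · simp only [suzukiE]
    refine pow_ne_zero _ (riemannXi_ne_zero_of_one_le_re ?_)
    simp only [Complex.sub_re, Complex.add_re, Complex.mul_re, Complex.I_re, Complex.I_im,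
      Complex.ofReal_re, Complex.ofReal_im]
    norm_num
    linarith

/-- **Suzuki 2021, Thm. 2.1 (second half) = Prop. 4.2, for `L = ζ`** (RH-FREE, unconditional, `τ`
INEXPLICIT): for `ω > 0`, `ν ≥ 1` with `νω > 1` (condition (2.8), `d_ζ = 1`) «there exists
`τ = τ(L;ω,ν) > 0` such that both `±1` are not the eigenvalues of `𝖪_L^{ω,ν}[t]` for every
`t ∈ [0,τ)`. In particular, the Fredholm determinant `det(1 ± 𝖪_L^{ω,ν}[t])` does not vanish for every
`t ∈ [0,τ)`» (the printed proof takes `t` small relative to a fixed `v`; no value of `τ` is given).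
Stated for the operator on `L²(−t,t)` (`NoUnitEigenvalue`). Named fact, not proved here. Users take
`(h : Suzuki2021_thm21)`. [cite: Suzuki2021Hamiltonians, Thm. 2.1 and Prop. 4.2] -/
def Suzuki2021_thm21 : Prop :=
  ∀ ω : ℝ, 0 < ω → ∀ ν : ℕ, 1 ≤ ν → 1 < (ν : ℝ) * ω →
    ∃ τ : ℝ, 0 < τ ∧ ∀ t : ℝ, 0 ≤ t → t < τ → NoUnitEigenvalue (suzukiKernel ω ν) t

/-- **Suzuki 2021, Prop. 4.1 (1) and (3), for `L = ζ`** (RH-FREE structure theorem for the kernel):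
for `ω > 0`, `ν ≥ 1`, `νω > 1`: (1) `K_ζ^{ω,ν}` and its archimedean constituent `G_ζ^{ω,ν}` vanish on
`(−∞, 0)`; (3) for `x > 0`, `x ∉ {log n}`,
`K_ζ^{ω,ν}(x) = Σ_{1 ≤ n ≤ eˣ} q_ζ^{ω,ν}(n) n^{−1/2} G_ζ^{ω,ν}(x − log n)` (eq. (4.8), `ε_ζ = 1`), where the
spectrally defined `K` ((2.6) on `Im z = 1 + ω`) «coincides with the function defined in (4.8) by
taking the Fourier inversion formula of (4.9)», (4.9) being `Θ(z) = ∫_0^∞ K(x) e^{izx} dx` for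
`Im z > ½ + ω` with absolute convergence. The sum is written over `n < N` for any `N > eˣ`
(terms with `log n > x` vanish by (1)). The identification of the spectral `G` (`suzukiArchKernel`)
with Suzuki's `g_ζ^{ω,ν}(eˣ) = (r ∗ g̃)(eˣ)` is (4.10)–(4.12). Named fact, not proved here (printed
proof: Beta integral (4.10) [Ob], Dirichlet expansion of `(ζ(s−ω)/ζ(s+ω))^ν`, Fubini). Users take
`(h : Suzuki2021_prop41)`. [cite: Suzuki2021Hamiltonians, Prop. 4.1 (1), (3), eqs. (4.7)–(4.9)] -/
def Suzuki2021_prop41 : Prop :=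
  ∀ ω : ℝ, 0 < ω → ∀ ν : ℕ, 1 ≤ ν → 1 < (ν : ℝ) * ω →
    (∀ x : ℝ, x < 0 → suzukiKernel ω ν x = 0 ∧ suzukiArchKernel ω ν x = 0) ∧
    ∀ N : ℕ, ∀ x : ℝ, 0 < x → x < Real.log (N : ℝ) → (∀ n : ℕ, x ≠ Real.log (n : ℝ)) →
      suzukiKernel ω ν x =
        ∑ n ∈ Finset.Icc 1 (N - 1),
          if Real.log (n : ℝ) ≤ x then
            suzukiCoeff ω ν n / Real.sqrt (n : ℝ) * suzukiArchKernel ω ν (x - Real.log (n : ℝ))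
          else 0

/-- **Suzuki 2021, Prop. 4.4, for `L = ζ`** (§4.4 «Non-vanishing of Fredholm determinants:
Conditional cases»): if `E_ζ^{ω,ν} ∈ HB` (hypothesis made explicit here; the section's standing
assumption, cf. §2.5: «If we suppose that `E_L^{ω,ν} ∈ HB`, the Fredholm determinant
`det(1 ± 𝖪_L^{ω,ν}[t])` does not vanish for every `t ≥ 0` (Proposition 4.4)») and (2.8) holds, then
«i) `𝖪[t]f = 0` for every `f ∈ L²(−∞,−t)`, ii) `‖𝖪[t]f‖ ≠ ‖f‖` for every `0 ≠ f ∈ L²(−∞,t)` … In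
particular, `1 ± 𝖪_L^{ω,ν}[t]` are invertible operators on `L²(−∞,t)` for every `t ≥ 0`» — recorded as:
`E ∈ HB` (`IsSuzukiHB`: strict inequality on `ℂ₊` AND no real zeros, Suzuki §1) ⇒ no unit eigenvalue
on `L²(−t,t)` for every `t ≥ 0`. Named fact, not proved here. Users take
`(h : Suzuki2021_prop44)`. [cite: Suzuki2021Hamiltonians, Prop. 4.4 (with §2.5)] -/
def Suzuki2021_prop44 : Prop :=
  ∀ ω : ℝ, 0 < ω → ∀ ν : ℕ, 1 ≤ ν → 1 < (ν : ℝ) * ω →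
    IsSuzukiHB (suzukiE ω ν) →
      ∀ t : ℝ, 0 ≤ t → NoUnitEigenvalue (suzukiKernel ω ν) t

/-! ## Proved consequences -/

/-- **The model regime is inhabited (Prop. 2.2 + Prop. 4.4):** for `ω ≥ ½`, `ν ≥ 1`, `νω > 1`, the
operator `𝖪_ζ^{ω,ν}[t]` has no unit eigenvalue for ANY `t ≥ 0` — the Hamiltonian `H_ζ^{ω,ν}` exists on
the whole half-line. Conditional only on the named fact `Suzuki2021_prop44` (Prop. 2.2 is proved).
RH-FREE. [cite: Suzuki2021Hamiltonians, Prop. 2.2 and Prop. 4.4] -/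
theorem suzuki2021_windows_of_half_le (h44 : Suzuki2021_prop44) {ω : ℝ} (hω : 1 / 2 ≤ ω) {ν : ℕ}
    (hν : 1 ≤ ν) (hνω : 1 < (ν : ℝ) * ω) {t : ℝ} (ht : 0 ≤ t) :
    NoUnitEigenvalue (suzukiKernel ω ν) t :=
  h44 ω (by linarith) ν hν hνω (Suzuki2021_prop22_holds ω hω ν hν) t ht

/-- Under Prop. 4.1 (1), the window sum for `N = 2` collapses: on `0 < x < log 2` the kernel is
purely archimedean, `K(x) = G(x)` (`q(1) = 1`; the column's "first rung" shape).
[cite: Suzuki2021Hamiltonians, Prop. 4.1 (3)] -/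
theorem suzukiKernel_eq_arch_of_lt_log_two (h41 : Suzuki2021_prop41) {ω : ℝ} (hω : 0 < ω) {ν : ℕ}
    (hν : 1 ≤ ν) (hνω : 1 < (ν : ℝ) * ω) {x : ℝ} (hx0 : 0 < x) (hx2 : x < Real.log 2)
    (hxn : ∀ n : ℕ, x ≠ Real.log (n : ℝ)) :
    suzukiKernel ω ν x = suzukiCoeff ω ν 1 * suzukiArchKernel ω ν x := by
  have h := (h41 ω hω ν hν hνω).2 2 x hx0 (by exact_mod_cast hx2) hxn
  rw [h]
  simp [hx0.le]

/-! ## Prop. 4.3 (1) ⇔ (2) for `L = ζ`: zero-free half-planes ⇔ the shifted structure functions in `HB`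
(PROVED, by Lagarias' Hadamard-product comparison under a zero-free hypothesis) -/

/-- Lagarias' shift inequality under a zero-free half-plane (Lagarias 2005 Lemma 2.1 (1) has `h ≥ ½`
unconditionally; here `h > ω₀` given `ζ ≠ 0` on `Re s > ½ + ω₀`, the step Suzuki's Prop. 4.3 proof
describes as «in a way similar to the proof of Proposition 2.2» via [LS] = Lagarias 2006): for
`Re s > ½`, `|ξ(h+1−s̄)| < |ξ(h+s)|`. Term by term in the grouped Hadamard product of `ξ`
(`IsHadamardSeq`): every zero `ρₙ`, `1−ρₙ` has real part `≤ ½ + ω₀ < h + ½`.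
[cite: Suzuki2021Hamiltonians, Prop. 4.3, proof of (1) ⇒ (2)] -/
theorem norm_riemannXi_shift_reflect_lt_of_zeroFree {ω₀ : ℝ}
    (hzf : ∀ s : ℂ, 1 / 2 + ω₀ < s.re → riemannZeta s ≠ 0) {h : ℝ} (hh : ω₀ < h) {s : ℂ}
    (hs : 1 / 2 < s.re) :
    ‖riemannXi ((h : ℂ) + 1 - conj s)‖ < ‖riemannXi ((h : ℂ) + s)‖ := by
  -- every zero `ρ` of `ξ` has `Re ρ ≤ ½ + ω₀ < h + ½`
  have hzero : ∀ ρ : ℂ, riemannXi ρ = 0 → ρ.re < h + 1 / 2 := by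
    intro ρ hρ
    have h3 := (riemannXi_eq_zero_iff_holds ρ).1 hρ
    by_contra hlt
    push Not at hlt
    exact hzf ρ (by linarith) h3.1
  have hu : riemannXi ((h : ℂ) + s) ≠ 0 := fun h0 ↦ by
    have := hzero _ h0
    simp only [add_re, ofReal_re] at this
    linarith
  by_cases hv : riemannXi ((h : ℂ) + 1 - conj s) = 0
  · rw [hv, norm_zero]; exact norm_pos_iff.2 hu
  obtain ⟨b, hb⟩ := exists_isHadamardSeq 0
  obtain ⟨n₀, hn₀⟩ := hb.exists_ne_zero
  have hsum := hb.hasSum_log_norm_factors_sub hu hv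
  have hfac : ∀ n, b n ≠ 0 →
      ‖1 - b n * (2 * ((h : ℂ) + 1 - conj s) - 1) ^ 2‖ < ‖1 - b n * (2 * ((h : ℂ) + s) - 1) ^ 2‖ := by
    intro n hn
    rw [IsHadamardSeq.factor_eq_mul b hn, IsHadamardSeq.factor_eq_mul b hn]
    simp only [norm_mul]
    have h4 : 0 < ‖(-4 : ℂ)‖ * ‖b n‖ :=
      mul_pos (norm_pos_iff.2 (by norm_num)) (norm_pos_iff.2 hn)
    refine mul_lt_mul_of_pos_left ?_ h4
    have hρ1 : (IsHadamardSeq.xiZero b n).re < h + 1 / 2 := hzero _ (hb.riemannXi_xiZero hn)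
    have hρ2 : (1 - IsHadamardSeq.xiZero b n).re < h + 1 / 2 :=
      hzero _ (hb.riemannXi_one_sub_xiZero hn)
    have h1 := norm_shift_reflect_sub_lt hs hρ1
    have h2 := norm_shift_reflect_sub_lt hs hρ2
    exact mul_lt_mul'' h1 h2 (norm_nonneg _) (norm_nonneg _)
  have hterm : ∀ n, b n ≠ 0 →
      0 < Real.log ‖1 - b n * (2 * ((h : ℂ) + s) - 1) ^ 2‖ -
        Real.log ‖1 - b n * (2 * ((h : ℂ) + 1 - conj s) - 1) ^ 2‖ := by
    intro n hn
    have hpos : 0 < ‖1 - b n * (2 * ((h : ℂ) + 1 - conj s) - 1) ^ 2‖ :=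
      norm_pos_iff.2 (hb.factor_ne_zero' hv n)
    have := Real.log_lt_log hpos (hfac n hn)
    linarith
  have hle : (fun _ : ℕ ↦ (0 : ℝ)) ≤ fun n ↦ Real.log ‖1 - b n * (2 * ((h : ℂ) + s) - 1) ^ 2‖ -
      Real.log ‖1 - b n * (2 * ((h : ℂ) + 1 - conj s) - 1) ^ 2‖ := by
    intro n
    by_cases hn : b n = 0
    · simp [hn]
    · exact (hterm n hn).le
  have hpos : (0 : ℝ) < Real.log ‖riemannXi ((h : ℂ) + s)‖ -
      Real.log ‖riemannXi ((h : ℂ) + 1 - conj s)‖ :=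
    hasSum_lt hle (hterm n₀ hn₀) hasSum_zero hsum
  have hv' : 0 < ‖riemannXi ((h : ℂ) + 1 - conj s)‖ := norm_pos_iff.2 hv
  have hu' : 0 < ‖riemannXi ((h : ℂ) + s)‖ := norm_pos_iff.2 hu
  rw [← Real.log_lt_log_iff hv' hu']
  linarith

/-- **Suzuki 2021, Prop. 4.3, (1) ⇔ (2), for `L = ζ`** (PROVED): for `ω₀ ≥ 0` and `ν ≥ 1`,
«`L(s) ≠ 0` for `Re(s) > ½ + ω₀`» ⇔ «`E_L^{ω,ν}` belongs to the class HB for every `ω > ω₀`»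
(«The value of `ν` does not affect the above equivalence»). The third equivalent (3) («`Θ_L^{ω,ν}` is a
meromorphic inner function in `ℂ₊` for every `ω > ω₀`») is not typed. At `ω₀ = 0` this is
(∀ ω > 0, `E_ζ^{ω,ν} ∈ HB`) ⇔ (no zeros in `Re s > ½`) — the HB form of RH (Prop. 2.1 / Lagarias 2006);
at `ω₀ = ½` the left side holds (`ζ ≠ 0` on `Re s ≥ 1`), recovering Prop. 2.2. RH-FREE statement
(an equivalence; no zero hypothesis is asserted). Proof: (1) ⇒ (2) by
`norm_riemannXi_shift_reflect_lt_of_zeroFree` with `h = ω`, `s = ½ − iz`, plus `ξ ≠ 0` on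
`Re s = ½ + ω`; (2) ⇒ (1): a zero `ρ` with `Re ρ > ½ + ω₀` (necessarily `< 1`) is a real zero
`x = −Im ρ` of `E^{ω,ν}` for `ω = Re ρ − ½ > ω₀`. [cite: Suzuki2021Hamiltonians, Prop. 4.3] -/
theorem Suzuki2021_prop43 {ω₀ : ℝ} (hω₀ : 0 ≤ ω₀) {ν : ℕ} (hν : 1 ≤ ν) :
    (∀ s : ℂ, 1 / 2 + ω₀ < s.re → riemannZeta s ≠ 0) ↔
      ∀ ω : ℝ, ω₀ < ω → IsSuzukiHB (suzukiE ω ν) := by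
  constructor
  · intro hzf ω hω
    refine ⟨fun z hz => ?_, fun x => ?_⟩
    · have hs : (1 / 2 : ℝ) < ((1 / 2 : ℂ) - I * z).re := by simp [hz]
      have key := norm_riemannXi_shift_reflect_lt_of_zeroFree hzf hω hs
      have e1 : (ω : ℂ) + 1 - conj ((1 / 2 : ℂ) - I * z) = 1 / 2 + ω - I * conj z := by
        simp only [map_sub, map_mul, Complex.conj_I, map_div₀, map_one, map_ofNat]
        ring
      have e2 : (ω : ℂ) + ((1 / 2 : ℂ) - I * z) = 1 / 2 + ω - I * z := by ring
      rw [e1, e2] at key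
      simp only [suzukiE, norm_pow]
      exact pow_lt_pow_left₀ key (norm_nonneg _) (by omega)
    · simp only [suzukiE]
      refine pow_ne_zero _ fun h0 => ?_
      have h3 := (riemannXi_eq_zero_iff_holds _).1 h0
      refine hzf _ ?_ h3.1
      simp only [sub_re, add_re, mul_re, I_re, I_im, ofReal_re, ofReal_im, one_div]
      norm_num
      linarith
  · intro hHB s hs hζ
    have hs1 : s.re < 1 := by
      by_contra h1
      push Not at h1
      exact riemannZeta_ne_zero_of_one_le_re h1 hζ
    have hξ : riemannXi s = 0 := (riemannXi_eq_zero_iff_holds s).2 ⟨hζ, by linarith, hs1⟩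
    have hω0 : ω₀ < s.re - 1 / 2 := by linarith
    have hx := (hHB (s.re - 1 / 2) hω0).2 (-s.im)
    apply hx
    simp only [suzukiE]
    have e : (1 / 2 : ℂ) + ((s.re - 1 / 2 : ℝ) : ℂ) - I * ((-s.im : ℝ) : ℂ) = s := by
      apply Complex.ext
      · simp
      · simp
    rw [e, hξ, zero_pow (by omega)]


/-- RH ⇔ `ζ` is zero-free on `Re s > ½` (the tree's strip form `riemannHypothesis_iff_strip_holds` plus the
functional equation `ξ(1−s) = ξ(s)` to exclude zeros with `0 < Re s < ½`). [folklore] -/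
private theorem riemannHypothesis_iff_zeroFree_half :
    RiemannHypothesis ↔ ∀ s : ℂ, 1 / 2 + (0 : ℝ) < s.re → riemannZeta s ≠ 0 := by
  have hstrip : RiemannHypothesis ↔ RiemannHypothesisStrip := riemannHypothesis_iff_strip_holds
  rw [hstrip]
  constructor
  · intro h s hs hζ
    rcases lt_or_ge s.re 1 with h1 | h1
    · have := h s hζ (by simp at hs; linarith) h1
      simp at hs
      linarith
    · exact riemannZeta_ne_zero_of_one_le_re h1 hζ
  · intro hzf s hζ h0 h1
    by_contra hne
    rcases lt_or_gt_of_ne hne with hlt | hgt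
    · have hξ : riemannXi s = 0 := (riemannXi_eq_zero_iff_holds s).2 ⟨hζ, h0, h1⟩
      have hξ' : riemannXi (1 - s) = 0 := by rw [riemannXi_one_sub]; exact hξ
      have h3 := (riemannXi_eq_zero_iff_holds _).1 hξ'
      exact hzf (1 - s) (by simp; linarith) h3.1
    · exact hzf s (by simp; linarith) hζ

/-- **RH in Suzuki's clothing** (Prop. 2.1 together with Prop. 4.3 at `ω₀ = 0`, for `L = ζ` and
Mathlib's `RiemannHypothesis`): RH ⇔ for every `ω > 0` the shifted structure function
`E_ζ^{ω,ν} = ξ(½+ω−iz)^ν` lies in `HB` (any fixed `ν ≥ 1`). RH-EQUIVALENT (a criterion — the door's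
frame, not a target); PROVED. [cite: Suzuki2021Hamiltonians, Prop. 2.1 and Prop. 4.3] -/
theorem riemannHypothesis_iff_forall_isSuzukiHB {ν : ℕ} (hν : 1 ≤ ν) :
    RiemannHypothesis ↔ ∀ ω : ℝ, 0 < ω → IsSuzukiHB (suzukiE ω ν) := by
  rw [riemannHypothesis_iff_zeroFree_half, Suzuki2021_prop43 le_rfl hν]


/-! ## Appendix B (rh-dbr round 2, W4): further printed statements of [Su21] for `L = ζ`

Suzuki's closure class `HB̄` (§1 (1.3): strict inequality on `ℂ₊`, real zeros allowed — the
standing assumption of §4.4), the Fourier integral formula (4.9) = Prop. 4.1 (3) (RH-free), the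
uncertainty Lemma 4.4 (RH-free: «it is not necessary to assume that `Θ` is inner in `ℂ₊` for
Lemma 4.4», end of its proof), and Prop. 4.4 ii)–iii) as printed under `E ∈ HB̄` (its i) is a
consequence of Prop. 4.1 (1) and is PROVED below from the fact `Suzuki2021_prop41`). The operator
`𝖪[t] = P_t 𝖪 P_t` on `L²(−∞,t)` (§3.1, (2.9)) kills `L²(−∞,−t)` and maps `L²(−t,t)` into
functions supported in `[−t,t]` (Prop. 4.4 i), (K3)), so its norm and its eigenvalues `±1` are
those of the block `f ↦ (x ↦ ∫_{(−t,t)} K(x+y) f(y) dy)` on `L²(−t,t)`; all statements below are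
written for that block, pointwise (the kernel is continuous, `f ∈ L²(−t,t) ⊂ L¹`). -/

/-- Suzuki's class `HB̄` [Su21, §1 (1.3)]: entire `E` with `|E♯(z)| < |E(z)|` for all `z ∈ ℂ₊`
(`|E♯(z)| = |E(z̄)|`; real zeros allowed). `HB = HB̄ ∩ {no real zeros}` is the tree's `IsSuzukiHB`.
[cite: Suzuki2021Hamiltonians, §1 eq. (1.3)] -/
def IsSuzukiHBbar (E : ℂ → ℂ) : Prop :=
  ∀ z : ℂ, 0 < z.im → ‖E (conj z)‖ < ‖E z‖

/-- `HB = HB̄ ∩ {no real zeros}` (by definition). [cite: Suzuki2021Hamiltonians, §1 eq. (1.3)] -/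
theorem isSuzukiHB_iff (E : ℂ → ℂ) : IsSuzukiHB E ↔ IsSuzukiHBbar E ∧ ∀ x : ℝ, E x ≠ 0 :=
  Iff.rfl

/-- **Suzuki 2021, Prop. 4.1 (3) = eq. (4.9), for `L = ζ`** — RH-FREE: «the Fourier integral
formula `Θ_L^{ω,ν}(z) = (𝖥K_L^{ω,ν})(z) = ∫_0^∞ K_L^{ω,ν}(x) e^{izx} dx` holds for
`Im(z) > 1/2 + ω` with the absolute convergence of the integral on the right-hand side» (for every
`(ω,ν) ∈ ℝ_{>0} × ℤ_{>0}`; the kernel of (4.8) «coincides with the function defined in (2.6)», i.e.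
with `suzukiKernel`). No zero of `ζ` enters (Mellin–Barnes for the `Γ`-quotient, absolutely
convergent Dirichlet series for `(ζ(s−ω)/ζ(s+ω))^ν`, `Re s > 1 + ω`). The `rh-dbr` theory seat's
`KernelLaplaceIdentity ω ν`, verbatim. Named fact, not proved here.
[cite: Suzuki2021Hamiltonians, Prop. 4.1 (3), eq. (4.9)] -/
def Suzuki2021_prop41_fourier : Prop :=
  ∀ ω : ℝ, 0 < ω → ∀ ν : ℕ, 1 ≤ ν → ∀ z : ℂ, 1 / 2 + ω < z.im →
    IntegrableOn (fun x : ℝ => (suzukiKernel ω ν x : ℂ) * Complex.exp (I * z * x)) (Set.Ioi 0) ∧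
      ∫ x in Set.Ioi (0 : ℝ), (suzukiKernel ω ν x : ℂ) * Complex.exp (I * z * x) =
        suzukiTheta ω ν z

/-- **Suzuki 2021, Lemma 4.4 (uncertainty), for `L = ζ`** — RH-FREE («As the above, it is not
necessary to assume that `Θ` is inner in `ℂ₊` for Lemma 4.4», end of its proof): «Let `t ≥ 0`.
Suppose that `(ω,ν)` satisfies (2.8). Then the support of `𝖪_L^{ω,ν} P_t f` is not compact for
every `f ∈ L²(ℝ)` unless `𝖪_L^{ω,ν} P_t f = 0`.» Recorded for `f` supported in `(−t,t)` (the case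
used in the proof of Prop. 4.4 ii)): then `(𝖪 P_t f)(x) = ∫_{(−t,t)} K(x+y) f(y) dy` vanishes for
`x < −t` by (K3), so "compact support" = "vanishes a.e. beyond some `R`", and the conclusion is
`𝖪 P_t f = 0` (a.e.). Mechanism: Paley–Wiener versus the `≍ T log T` zeros of the numerator of
`Θ` (Lemma 4.3). NOT included: the injectivity `𝖪P_t f = 0 ⇒ f = 0` (under `E ∈ HB̄` it is the
isometry of Lemma 3.2). Named fact, not proved here. [cite: Suzuki2021Hamiltonians, Lemma 4.4] -/
def Suzuki2021_lemma44 : Prop :=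
  ∀ ω : ℝ, 0 < ω → ∀ ν : ℕ, 1 ≤ ν → 1 < (ν : ℝ) * ω → ∀ t : ℝ, 0 ≤ t →
    ∀ f : ℝ → ℝ, MemLp f 2 (volume.restrict (Set.Ioo (-t) t)) →
      (∃ R : ℝ, ∀ᵐ x ∂(volume.restrict (Set.Ioi R)),
          ∫ y in Set.Ioo (-t) t, suzukiKernel ω ν (x + y) * f y = 0) →
        (fun x : ℝ => ∫ y in Set.Ioo (-t) t, suzukiKernel ω ν (x + y) * f y) =ᵐ[volume] 0

/-- **Suzuki 2021, Prop. 4.4 ii)–iii) as printed, for `L = ζ`**, under the standing assumption of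
§4.4 «We suppose that `E_L^{ω,ν} ∈ HB̄` throughout this subsection» (`IsSuzukiHBbar`) and (2.8):
«Let `t ≥ 0`. We have i) `𝖪[t]f = 0` for every `f ∈ L²(−∞,−t)`, ii) `‖𝖪[t]f‖ ≠ ‖f‖` for every
`0 ≠ f ∈ L²(−∞,t)`, and iii) `‖𝖪[t]‖ < 1`» (iii) is printed with the typo `‖𝖧_{ω,a}‖ < 1`; the
proof shows `‖𝖪_L^{ω,ν}[t]‖ < 1`). By i) (a theorem, `suzuki2021_prop44_i`) `𝖪[t]` is `0 ⊕ B` on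
`L²(−∞,−t) ⊕ L²(−t,t)` with `B f = P_t ∫_{(−t,t)} K(·+y) f(y) dy`, so ii) and iii) are recorded for
`B`: ii) `‖Bf‖² ≠ ‖f‖²` for `f ≠ 0`; iii) `∃ c < 1, ‖Bf‖² ≤ c‖f‖²` — the `rh-dbr` theory seat's
`OpNormWindow ω ν t` verbatim. Stronger than the tree's `Suzuki2021_prop44` (hypothesis `HB`,
conclusion "no unit eigenvalue"), which it implies (`Suzuki2021_prop44_of_norm`). Named fact, not
proved here. [cite: Suzuki2021Hamiltonians, Prop. 4.4] -/
def Suzuki2021_prop44_norm : Prop :=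
  ∀ ω : ℝ, 0 < ω → ∀ ν : ℕ, 1 ≤ ν → 1 < (ν : ℝ) * ω → IsSuzukiHBbar (suzukiE ω ν) →
    ∀ t : ℝ, 0 ≤ t →
      (∀ f : ℝ → ℝ, MemLp f 2 (volume.restrict (Set.Ioo (-t) t)) →
          ¬ (f =ᵐ[volume.restrict (Set.Ioo (-t) t)] 0) →
          ∫ x in Set.Ioo (-t) t, (∫ y in Set.Ioo (-t) t, suzukiKernel ω ν (x + y) * f y) ^ 2 ≠
            ∫ x in Set.Ioo (-t) t, f x ^ 2) ∧
      (∃ c : ℝ, c < 1 ∧ ∀ f : ℝ → ℝ, MemLp f 2 (volume.restrict (Set.Ioo (-t) t)) →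
          ∫ x in Set.Ioo (-t) t, (∫ y in Set.Ioo (-t) t, suzukiKernel ω ν (x + y) * f y) ^ 2 ≤
            c * ∫ x in Set.Ioo (-t) t, f x ^ 2)

/-- **Prop. 4.4 i), PROVED from Prop. 4.1 (1)**: for `x ≤ t` and `f` living on `(−∞,−t)` the
integrand `K(x+y) f(y)` vanishes identically (`x + y < 0`, (K3)), so `𝖪[t]f = 0` on `L²(−∞,−t)`.
[cite: Suzuki2021Hamiltonians, Prop. 4.4 i)] -/
theorem suzuki2021_prop44_i (h41 : Suzuki2021_prop41) {ω : ℝ} (hω : 0 < ω) {ν : ℕ} (hν : 1 ≤ ν)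
    (hνω : 1 < (ν : ℝ) * ω) {t x : ℝ} (hx : x ≤ t) (f : ℝ → ℝ) :
    ∫ y in Set.Iio (-t), suzukiKernel ω ν (x + y) * f y = 0 := by
  refine setIntegral_eq_zero_of_forall_eq_zero fun y hy => ?_
  have hxy : x + y < 0 := by rw [Set.mem_Iio] at hy; linarith
  rw [((h41 ω hω ν hν hνω).1 (x + y) hxy).1, zero_mul]

/-- `Suzuki2021_prop44_norm` (hypothesis `HB̄`, conclusion `‖𝖪[t]‖ < 1`) implies the tree's
`Suzuki2021_prop44` (hypothesis `HB ⊂ HB̄`, conclusion: no eigenvalue `±1` on `L²(−t,t)`): an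
eigenfunction `𝖪f = ±f` would give `‖f‖² = ‖Bf‖² ≤ c‖f‖²`, `c < 1`, so `f = 0` a.e.
[cite: Suzuki2021Hamiltonians, Prop. 4.4] -/
theorem Suzuki2021_prop44_of_norm (h : Suzuki2021_prop44_norm) : Suzuki2021_prop44 := by
  intro ω hω ν hν hνω hHB t ht ε hε f hf heig
  obtain ⟨c, hc1, hc⟩ := (h ω hω ν hν hνω hHB.1 t ht).2
  set μ : Measure ℝ := volume.restrict (Set.Ioo (-t) t) with hμ
  have hε2 : ε ^ 2 = 1 := by rcases hε with rfl | rfl <;> norm_num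
  -- `‖Bf‖² = ‖f‖²` from the eigen-equation
  have hsq : ∫ x in Set.Ioo (-t) t, (∫ y in Set.Ioo (-t) t, suzukiKernel ω ν (x + y) * f y) ^ 2 =
      ∫ x in Set.Ioo (-t) t, f x ^ 2 := by
    refine integral_congr_ae ?_
    filter_upwards [heig] with x hx
    rw [hx, mul_pow, hε2, one_mul]
  have hle := hc f hf
  rw [hsq] at hle
  -- hence `∫ f² = 0`
  have hint : Integrable (fun x => f x ^ 2) μ := by
    have := hf.integrable_sq
    exact this
  have hnn : 0 ≤ ∫ x in Set.Ioo (-t) t, f x ^ 2 := integral_nonneg fun x => sq_nonneg (f x)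
  have hzero : ∫ x in Set.Ioo (-t) t, f x ^ 2 = 0 := by nlinarith
  have hae : (fun x => f x ^ 2) =ᵐ[μ] 0 :=
    (integral_eq_zero_iff_of_nonneg (fun x => sq_nonneg (f x)) hint).1 hzero
  filter_upwards [hae] with x hx
  simpa using pow_eq_zero_iff (n := 2) (by norm_num) |>.1 hx

end Literature.NumberTheory.LFunctions

end
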